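import Literature.Computability.AlgebraicComplexity.IsotypicOccurrenceSemigroup
import HarnessLib

/-!
# Occurring triples have positive Kronecker coefficient (`S(t) ⊆ K`, i.e. `Δ(t) ⊆ Kron(a,b,c)`)

Topic `Computability/AlgebraicComplexity`; proofs file (theorems only, no definitions, no named
facts), companion of `IsotypicOccurrenceSemigroup.lean`, written while serving the named fact
`vandenBergEtAl2025_unitTensor_four_polytope_maximal` (`UnitTensorMomentPolytope.lean`). The
hypothesis of that fact is that a partition triple `λ = (λ⁽⁰⁾, λ⁽¹⁾, λ⁽²⁾) ⊢ n` OCCURS in a tensor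
power `s^{⊗n}` (the triple isotypic character sum of `QuantumFunctionalsUpper.lean` does not kill
`kroneckerPow s n`). The first step of every argument about such triples is that they lie in the
*Kronecker semigroup*: this file PROVES

* `kroneckerCoeff_pos_of_isotypicSum₁₂₃_kroneckerPow_ne_zero` — if `λ` occurs in `t^{⊗n}` for a
  complex 3-tensor `t` on arbitrary finite index types, then the Kronecker coefficient is positive,
  `0 < kroneckerCoeff ℂ λ⁽⁰⁾ λ⁽¹⁾ λ⁽²⁾` (the tree's `g`, `SymmetricGroupReps`).

This is Bürgisser–Ikenmeyer's `S(w) ⊆ K(m)` [BurgisserIkenmeyer2011, §3.2 with (10.3):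
"`g(λ) = mult(V_λ(G)*, 𝒪(W)_d)`", and `𝒪(W)_d ↠ 𝒪(cl(Gw))_d`], i.e. `Δ(T) ⊆ Kron(a,b,c)` — "For
every tensor `T ∈ ℂᵃ⊗ℂᵇ⊗ℂᶜ`, we have `Δ(T) ⊆ Δ(ℂᵃ⊗ℂᵇ⊗ℂᶜ)`", the Kronecker polytope, which "has an
alternative description in terms of the Kronecker coefficients"
[vandenBergChristandlLysikovNieuwboerWalterZuiddam2025, §1]. With the Schur–Weyl vanishing
`schurWeyl_isotypicSum_eq_zero_holds` (at most `|ι|, |κ|, |μ|` parts) it places the hypothesis of the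
named fact inside the format-`4` Kronecker semigroup `K(4,4,4)`, whose normalised closure is
`Kron(4,4,4)`; what the named fact asserts beyond this file and its companion is the computer-verified
inclusion `Kron(4,4,4) ⊆ Δ(⟨4⟩)`.

## Proof

In the word model with ONE alphabet `Fin N` for the three factors (§1): by
`exists_pairing_ne_zero_of_isotypicSum₁₂₃_kroneckerPow_ne_zero` (companion file; Schur–Weyl duality
in span form) an occurring triple yields highest-weight vectors `ξ₁, ξ₂, ξ₃` of weights `λ⁽ʲ⁾` and a
translate `x = (A ⊗ B ⊗ C)·t` with `⟪x^{⊗n}, ξ₁ ⊗ ξ₂ ⊗ ξ₃⟫ ≠ 0`. The symmetrisation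
`M = ∑_{τ ∈ S_n} τ·(ξ₁ ⊗ ξ₂ ⊗ ξ₃)` under the diagonal position action is an `S_n`-invariant element of
the slice space `HW_λ ⊗ HW_μ ⊗ HW_ν` (tree: `tripleHw`, `sym3_mem_tripleHw`), and it is NONZERO because
`x^{⊗n}` is invariant under the diagonal action (`permLegs_kroneckerPow`), so
`⟪x^{⊗n}, M⟫ = n! ⟪x^{⊗n}, ξ₁ ⊗ ξ₂ ⊗ ξ₃⟫ ≠ 0`. The invariants of the slice space have dimension
`g(λ, μ, ν)` (tree: `kroneckerCoeff_pos_of_invariant`, `KroneckerSemigroup.lean`, the mechanism of the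
Christandl–Harrow–Mitchison / Ikenmeyer–Panova semigroup property). Three alphabets `Fin a, Fin b,
Fin c` embed into the common alphabet `Fin (a+b+c)` by inclusion matrices `Φ` with `Φᵀ Φ = 1`
(tree: `transpose_submatrix_one_mul_self`), occurrence being monotone under restriction (§2), and
arbitrary finite index types are relabelled (§3).

## References

* [BurgisserIkenmeyer2011] P. Bürgisser, C. Ikenmeyer, *Geometric complexity theory and tensor
  rank*, STOC 2011 = arXiv:1011.1350, §3.1 (Def. 3.1), §3.2 (Kronecker semigroup `K(m)`), (10.3).
* [vandenBergChristandlLysikovNieuwboerWalterZuiddam2025] M. van den Berg et al., arXiv:2503.22633,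
  §1 ("Kronecker polytope and moment polytopes for matrix multiplication and unit tensors").
* [IkenmeyerPanova2017] C. Ikenmeyer, G. Panova, Adv. Math. 319 (2017), §1.1.
* [ChristandlVranaZuiddam2023] M. Christandl, P. Vrana, J. Zuiddam, J. Amer. Math. Soc. 36 (2023),
  §3.1.
-/

noncomputable section

open scoped BigOperators Matrix

namespace Literature.Computability.AlgebraicComplexity

open Literature.NumberTheory.DiophantineGeometry (Word wordRep highestWeightSpace Weight Word3 permute3
  permute3_mul permute3_one sym3 tripleHw mem_tripleHw_iff sym3_mem_tripleHw sym3_permute3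
  kroneckerCoeff kroneckerCoeff_pos_of_invariant)

/-! ## §1 One alphabet `Fin N`: the symmetrised triad is a nonzero invariant of `HW_λ ⊗ HW_μ ⊗ HW_ν` -/

section OneAlphabet

variable {N n : ℕ}

/-- A triad `ξ₁ ⊗ ξ₂ ⊗ ξ₃` of highest-weight vectors, read as a function of triples of words, lies in
the triple slice space `HW_{χ₁} ⊗ HW_{χ₂} ⊗ HW_{χ₃}` (`tripleHw`). [folklore] -/
theorem triad_mem_tripleHw {χ₁ χ₂ χ₃ : Weight (Fin N)} {ξ₁ ξ₂ ξ₃ : Word N n → ℂ}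
    (h₁ : ξ₁ ∈ highestWeightSpace (wordRep ℂ N n) χ₁) (h₂ : ξ₂ ∈ highestWeightSpace (wordRep ℂ N n) χ₂)
    (h₃ : ξ₃ ∈ highestWeightSpace (wordRep ℂ N n) χ₃) :
    (fun w : Word3 N n => triad ξ₁ ξ₂ ξ₃ w.1.1 w.1.2 w.2) ∈ tripleHw ℂ N n χ₁ χ₂ χ₃ := by
  rw [mem_tripleHw_iff]
  refine ⟨fun w₂ w₃ => ?_, fun w₁ w₃ => ?_, fun w₁ w₂ => ?_⟩
  · have e : (fun w₁ => triad ξ₁ ξ₂ ξ₃ w₁ w₂ w₃) = (ξ₂ w₂ * ξ₃ w₃) • ξ₁ := by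
      funext w₁; simp only [triad_apply, Pi.smul_apply, smul_eq_mul]; ring
    simpa only [e] using Submodule.smul_mem _ (ξ₂ w₂ * ξ₃ w₃) h₁
  · have e : (fun w₂ => triad ξ₁ ξ₂ ξ₃ w₁ w₂ w₃) = (ξ₁ w₁ * ξ₃ w₃) • ξ₂ := by
      funext w₂; simp only [triad_apply, Pi.smul_apply, smul_eq_mul]; ring
    simpa only [e] using Submodule.smul_mem _ (ξ₁ w₁ * ξ₃ w₃) h₂
  · have e : (fun w₃ => triad ξ₁ ξ₂ ξ₃ w₁ w₂ w₃) = (ξ₁ w₁ * ξ₂ w₂) • ξ₃ := by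
      funext w₃; simp only [triad_apply, Pi.smul_apply, smul_eq_mul]
    simpa only [e] using Submodule.smul_mem _ (ξ₁ w₁ * ξ₂ w₂) h₃

/-- The diagonal position action of `τ` on triples of words, as a bijection. [folklore] -/
theorem permute3_bijective (τ : Equiv.Perm (Fin n)) : Function.Bijective (permute3 (N := N) τ) := by
  refine Function.bijective_iff_has_inverse.2 ⟨permute3 τ⁻¹, fun w => ?_, fun w => ?_⟩
  · show permute3 τ⁻¹ (permute3 τ w) = w
    rw [← permute3_mul, mul_inv_cancel, permute3_one]
  · show permute3 τ (permute3 τ⁻¹ w) = w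
    rw [← permute3_mul, inv_mul_cancel, permute3_one]

/-- A tensor power is invariant under the diagonal position action on triples of words
(`permLegs_kroneckerPow`). [cite: ChristandlVranaZuiddam2023, §3.1] -/
theorem kroneckerPow_permute3 (x : Fin N → Fin N → Fin N → ℂ) (τ : Equiv.Perm (Fin n))
    (w : Word3 N n) :
    kroneckerPow x n (permute3 τ w).1.1 (permute3 τ w).1.2 (permute3 τ w).2 =
      kroneckerPow x n w.1.1 w.1.2 w.2 := by
  have h := congrFun (congrFun (congrFun (permLegs_kroneckerPow τ x) w.1.1) w.1.2) w.2
  simp only [permLegs₁_apply, permLegs₂_apply, permLegs₃_apply] at h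
  exact h

/-- **Pairing with a symmetrisation**: `⟪x^{⊗n}, ∑_τ τ·H⟫ = n! ⟪x^{⊗n}, H⟫`, since `x^{⊗n}` is
invariant under the diagonal position action. [folklore] -/
theorem sum_kroneckerPow_mul_sym3 (x : Fin N → Fin N → Fin N → ℂ) (H : Word3 N n → ℂ) :
    ∑ w : Word3 N n, kroneckerPow x n w.1.1 w.1.2 w.2 * sym3 H w =
      (Fintype.card (Equiv.Perm (Fin n)) : ℂ) *
        ∑ w : Word3 N n, kroneckerPow x n w.1.1 w.1.2 w.2 * H w := by
  have hτ : ∀ τ : Equiv.Perm (Fin n),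
      ∑ w : Word3 N n, kroneckerPow x n w.1.1 w.1.2 w.2 * H (permute3 τ w) =
        ∑ w : Word3 N n, kroneckerPow x n w.1.1 w.1.2 w.2 * H w := by
    intro τ
    refine Fintype.sum_bijective (permute3 τ) (permute3_bijective τ) _ _ fun w => ?_
    rw [kroneckerPow_permute3]
  calc ∑ w : Word3 N n, kroneckerPow x n w.1.1 w.1.2 w.2 * sym3 H w
      = ∑ w : Word3 N n, ∑ τ : Equiv.Perm (Fin n),
          kroneckerPow x n w.1.1 w.1.2 w.2 * H (permute3 τ w) := by
        refine Finset.sum_congr rfl fun w _ => ?_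
        rw [show sym3 H w = ∑ τ : Equiv.Perm (Fin n), H (permute3 τ w) from rfl, Finset.mul_sum]
    _ = ∑ τ : Equiv.Perm (Fin n), ∑ w : Word3 N n,
          kroneckerPow x n w.1.1 w.1.2 w.2 * H (permute3 τ w) := Finset.sum_comm
    _ = ∑ τ : Equiv.Perm (Fin n), ∑ w : Word3 N n, kroneckerPow x n w.1.1 w.1.2 w.2 * H w :=
        Finset.sum_congr rfl fun τ _ => hτ τ
    _ = (Fintype.card (Equiv.Perm (Fin n)) : ℂ) *
          ∑ w : Word3 N n, kroneckerPow x n w.1.1 w.1.2 w.2 * H w := by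
        rw [Finset.sum_const, Finset.card_univ, nsmul_eq_mul]

/-- **Occurring triples have positive Kronecker coefficient** (one alphabet `Fin N` for the three
factors): if `λ = (λ⁽⁰⁾, λ⁽¹⁾, λ⁽²⁾)` occurs in `t^{⊗n}` then `g(λ⁽⁰⁾, λ⁽¹⁾, λ⁽²⁾) > 0`. Proof: a
non-vanishing pairing `⟪x^{⊗n}, ξ₁ ⊗ ξ₂ ⊗ ξ₃⟫ ≠ 0` with highest-weight vectors
(`exists_pairing_ne_zero_of_isotypicSum₁₂₃_kroneckerPow_ne_zero`) makes the symmetrisation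
`∑_τ τ·(ξ₁ ⊗ ξ₂ ⊗ ξ₃)` a NONZERO `S_n`-invariant of `HW_λ ⊗ HW_μ ⊗ HW_ν` (its pairing with the
symmetric tensor `x^{⊗n}` is `n!` times the original one), and the invariants of that space have
dimension `g(λ, μ, ν)` (tree: `kroneckerCoeff_pos_of_invariant`). This is `S(w) ⊆ K(m)`
(BI 2011 §3.2 with (10.3): `g(λ) = mult(V_λ*, 𝒪(W)_d)` and `𝒪(W)_d ↠ 𝒪(cl(Gw))_d`), i.e.
`Δ(T) ⊆ Kron(a,b,c)` (vdBCLNWZ 2025 §1). [cite: BurgisserIkenmeyer2011, §3.2 and (10.3)]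
[cite: vandenBergChristandlLysikovNieuwboerWalterZuiddam2025, §1 (Kronecker polytope)] -/
theorem kroneckerCoeff_pos_of_isotypicSum₁₂₃_kroneckerPow_ne_zero_one {lam : Fin 3 → Nat.Partition n}
    {t : Fin N → Fin N → Fin N → ℂ}
    (h : isotypicSum₁ (lam 0) (isotypicSum₂ (lam 1) (isotypicSum₃ (lam 2) (kroneckerPow t n))) ≠ 0) :
    0 < kroneckerCoeff ℂ (lam 0) (lam 1) (lam 2) := by
  obtain ⟨A, B, C, ξ₁, ξ₂, ξ₃, h₁, h₂, h₃, hne⟩ :=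
    exists_pairing_ne_zero_of_isotypicSum₁₂₃_kroneckerPow_ne_zero h
  -- the vectors are nonzero, so the shapes fit the alphabet
  have hξ₁ : ξ₁ ≠ 0 := by rintro rfl; simp at hne
  have hξ₂ : ξ₂ ≠ 0 := by rintro rfl; simp at hne
  have hξ₃ : ξ₃ ≠ 0 := by rintro rfl; simp at hne
  have hl := card_parts_le_of_mem_highestWeightSpace_ne_zero h₁ hξ₁
  have hm := card_parts_le_of_mem_highestWeightSpace_ne_zero h₂ hξ₂
  have hn := card_parts_le_of_mem_highestWeightSpace_ne_zero h₃ hξ₃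
  -- the pairing as a sum over triples of words
  set x := actTensor A B C t with hx
  have hpair : ∑ w : Word3 N n, kroneckerPow x n w.1.1 w.1.2 w.2 *
      (fun w : Word3 N n => triad ξ₁ ξ₂ ξ₃ w.1.1 w.1.2 w.2) w ≠ 0 := by
    rw [Fintype.sum_prod_type, Fintype.sum_prod_type]
    exact hne
  -- the symmetrised triad is a nonzero invariant triple tensor
  refine kroneckerCoeff_pos_of_invariant hl hm hn
    (M := sym3 fun w : Word3 N n => triad ξ₁ ξ₂ ξ₃ w.1.1 w.1.2 w.2)
    (sym3_mem_tripleHw (triad_mem_tripleHw h₁ h₂ h₃)) ?_ (fun τ w => sym3_permute3 _ τ w)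
  intro h0
  have key := sum_kroneckerPow_mul_sym3 x (fun w : Word3 N n => triad ξ₁ ξ₂ ξ₃ w.1.1 w.1.2 w.2)
  rw [h0] at key
  simp only [Pi.zero_apply, mul_zero, Finset.sum_const_zero] at key
  exact hpair ((mul_eq_zero.1 key.symm).resolve_left (Nat.cast_ne_zero.2 Fintype.card_ne_zero))

end OneAlphabet

/-! ## §2 Three alphabets `Fin a, Fin b, Fin c`: embed into a common alphabet -/

section ThreeAlphabets

variable {a b c n : ℕ}

/-- The tensor embedded along injective letter maps restricts back to the original tensor
(`Φᵀ Φ = 1` for inclusion matrices `Φ`). [folklore] -/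
theorem tensorRestrictsTo_actTensor_submatrix_one {N : ℕ} {φ₁ : Fin a → Fin N} {φ₂ : Fin b → Fin N}
    {φ₃ : Fin c → Fin N} (hφ₁ : Function.Injective φ₁) (hφ₂ : Function.Injective φ₂)
    (hφ₃ : Function.Injective φ₃) (t : Fin a → Fin b → Fin c → ℂ) :
    TensorRestrictsTo (actTensor ((1 : Matrix (Fin N) (Fin N) ℂ).submatrix id φ₁)
      ((1 : Matrix (Fin N) (Fin N) ℂ).submatrix id φ₂) ((1 : Matrix (Fin N) (Fin N) ℂ).submatrix id φ₃) t) t := by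
  rw [tensorRestrictsTo_iff_exists_actTensor]
  refine ⟨((1 : Matrix (Fin N) (Fin N) ℂ).submatrix id φ₁)ᵀ, ((1 : Matrix (Fin N) (Fin N) ℂ).submatrix id φ₂)ᵀ,
    ((1 : Matrix (Fin N) (Fin N) ℂ).submatrix id φ₃)ᵀ, ?_⟩
  rw [actTensor_actTensor, transpose_submatrix_one_mul_self hφ₁, transpose_submatrix_one_mul_self hφ₂,
    transpose_submatrix_one_mul_self hφ₃, actTensor_one]

/-- **Occurring triples have positive Kronecker coefficient** (alphabets `Fin a, Fin b, Fin c`).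
[cite: BurgisserIkenmeyer2011, §3.2 and (10.3)]
[cite: vandenBergChristandlLysikovNieuwboerWalterZuiddam2025, §1 (Kronecker polytope)] -/
theorem kroneckerCoeff_pos_of_isotypicSum₁₂₃_kroneckerPow_ne_zero_fin {lam : Fin 3 → Nat.Partition n}
    {t : Fin a → Fin b → Fin c → ℂ}
    (h : isotypicSum₁ (lam 0) (isotypicSum₂ (lam 1) (isotypicSum₃ (lam 2) (kroneckerPow t n))) ≠ 0) :
    0 < kroneckerCoeff ℂ (lam 0) (lam 1) (lam 2) := by
  have ha : a ≤ a + b + c := by omega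
  have hb : b ≤ a + b + c := by omega
  have hc : c ≤ a + b + c := by omega
  have hts := tensorRestrictsTo_actTensor_submatrix_one (Fin.castLE_injective ha)
    (Fin.castLE_injective hb) (Fin.castLE_injective hc) t
  exact kroneckerCoeff_pos_of_isotypicSum₁₂₃_kroneckerPow_ne_zero_one
    (isotypicSum₁₂₃_kroneckerPow_ne_zero_of_restrictsTo hts h)

end ThreeAlphabets

/-! ## §3 Arbitrary finite index types -/

section General

variable {ι κ μ : Type} [Fintype ι] [Fintype κ] [Fintype μ] {n : ℕ}

/-- **`S(t) ⊆ K`: every partition triple occurring in a tensor power of `t ∈ ℂ^ι ⊗ ℂ^κ ⊗ ℂ^μ` has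
positive Kronecker coefficient** — the semigroup of representations of the orbit closure lies in
the Kronecker semigroup (BI 2011 §3.2, (10.3)), equivalently the moment polytope of every tensor
lies in the Kronecker polytope, `Δ(T) ⊆ Kron(a,b,c)` (vdBCLNWZ 2025 §1). Together with the
Schur–Weyl vanishing `schurWeyl_isotypicSum_eq_zero_holds` (at most `|ι|, |κ|, |μ|` parts) this is
the containment of the hypothesis side of `vandenBergEtAl2025_unitTensor_four_polytope_maximal` in
the format-`4` Kronecker semigroup. [cite: BurgisserIkenmeyer2011, §3.2 and (10.3)]
[cite: vandenBergChristandlLysikovNieuwboerWalterZuiddam2025, §1 (Kronecker polytope)] -/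
theorem kroneckerCoeff_pos_of_isotypicSum₁₂₃_kroneckerPow_ne_zero {lam : Fin 3 → Nat.Partition n}
    {t : ι → κ → μ → ℂ}
    (h : isotypicSum₁ (lam 0) (isotypicSum₂ (lam 1) (isotypicSum₃ (lam 2) (kroneckerPow t n))) ≠ 0) :
    0 < kroneckerCoeff ℂ (lam 0) (lam 1) (lam 2) := by
  classical
  rw [← isotypicSum₁₂₃_kroneckerPow_ne_zero_relabel_iff t (Fintype.equivFin ι) (Fintype.equivFin κ)
    (Fintype.equivFin μ)] at h
  exact kroneckerCoeff_pos_of_isotypicSum₁₂₃_kroneckerPow_ne_zero_fin h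

end General

end Literature.Computability.AlgebraicComplexity
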